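import Literature.Analysis.FluidPDE.ClassicalDriftNSLocalEnergy
import HarnessLib

/-!
# The weak (pressure-free, divergence-free-tested, time-sliced) form of the drift system for
# classical solutions

Analysis/FluidPDE support file serving the discharge of
`Literature.Analysis.FluidPDE.leray_regularised_wellposed` (its `regularised` field: the
regularised equations "in the weak (pressure-free, divergence-free-tested, time-sliced) form of
`NS.IsLerayRegularisedScheme`"). For a classical solution of the drift system
`∂ₜu + (w·∇)u = νΔu − ∇p`, `div u = div w = 0` (`IsClassicalDriftNSSolutionOn`,
`ClassicalDriftNSLocalEnergy`; `w = J_εu` is Leray's regularised system (5.1), `w = u` the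
Navier–Stokes system) on a time set `S ⊇ [s, t]` of unique differentiability, and every smooth
compactly supported space–time field `ψ` with divergence-free slices,

  `⟪u(t), ψ(t)⟫ − ⟪u(s), ψ(s)⟫ = ∫ₛᵗ ∫ (⟪u, ∂ₜψ⟫ + ⟪u, (w·∇)ψ⟫ + ν⟪u, Δψ⟫) dx dτ`

(Leray 1934, §III (17) p. 206 and Ch. V (5.1); Ożański–Pooley 2018, Def. 6.32 / (6.78) and
(6.89): the pressure drops out against divergence-free tests, the transport and viscous terms are
moved onto the test field, and the time derivative is integrated between `s` and `t`). This is
literally the shape of the `regularised` field of `IsLerayRegularisedScheme` /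
`leray_regularised_wellposed` (`NSLerayRegularised*`), for any classical construction smooth up to
the times `s`, `t` considered.

## Contents (all proved)

* `IsClassicalDriftNSSolutionOn.integral_inner_timeDerivWithin_test` — the slice identity
  `∫ ⟪∂ₜu(τ), ψτ⟫ = ∫ ⟪u, (w·∇)ψτ⟫ + ν ∫ ⟪u, Δψτ⟫` (the drift twin of the tree's
  `IsClassicalNSSolutionOn.integral_inner_timeDerivWithin_test`);
* `IsClassicalDriftNSSolutionOn.inner_sub_inner_eq_intervalIntegral` — the two-time identity
  displayed above.

## References

* J. Leray, Acta Math. 63 (1934), §III (17) p. 206; Ch. V §26 (5.1). [Leray1934]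
* W. S. Ożański, B. C. Pooley, LMS Lecture Note Ser. 452 (2018) = arXiv:1708.09787, Def. 6.32,
  (6.78), (6.89). [OzanskiPooley2018]
-/

noncomputable section

open MeasureTheory TopologicalSpace Set Function Filter InnerProductSpace
open scoped ENNReal NNReal Laplacian RealInnerProductSpace ContDiff Topology

namespace Literature.Analysis.FluidPDE

variable {E : Type*} [NormedAddCommGroup E] [InnerProductSpace ℝ E] [FiniteDimensional ℝ E]
  [MeasurableSpace E] [BorelSpace E]
variable {S : Set ℝ} {ν : ℝ} {w u : ℝ → E → E} {p : ℝ → E → ℝ}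

/-- **The slice identity behind the weak formulation of the drift system.** For a classical drift
solution on a time set `S`, `t ∈ S`, and a divergence-free
`ψt ∈ C²_c(E; E)`: `∫ ⟪∂ₜu(t), ψt⟫ = ∫ ⟪u(t), (w(t)·∇)ψt⟫ + ν ∫ ⟪u(t), Δψt⟫` — the pressure drops
out (`∫ ⟪∇p, ψt⟫ = −∫ p div ψt = 0`), `∫ ⟪Δu, ψt⟫ = ∫ ⟪u, Δψt⟫`, and
`∫ ⟪(w·∇)u, ψt⟫ = −∫ ⟪u, (w·∇)ψt⟫` since `div w = 0` (Leray 1934, §III, derivation of (17);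
Ożański–Pooley 2018, (6.78)). [cite: Leray1934, (17) p. 206] -/
theorem IsClassicalDriftNSSolutionOn.integral_inner_timeDerivWithin_test
    (h : IsClassicalDriftNSSolutionOn S ν w u p) {t : ℝ} (ht : t ∈ S)
    {ψt : E → E} (hψ : ContDiff ℝ 2 ψt) (hc : HasCompactSupport ψt)
    (hdiv : VectorCalculus.IsDivFree ψt) :
    ∫ x, ⟪timeDerivWithin S u t x, ψt x⟫ =
      ∫ x, (⟪u t x, convect (w t) ψt x⟫ + ν * ⟪u t x, (Δ ψt) x⟫) := by
  -- regularity of the slices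
  have hu2 : ContDiff ℝ 2 (u t) := contDiff_infty.1 (h.smooth_velocity.contDiff_slice ht) 2
  have hu1 : ContDiff ℝ 1 (u t) := hu2.of_le one_le_two
  have hw1 : ContDiff ℝ 1 (w t) := contDiff_infty.1 (h.smooth_drift.contDiff_slice ht) 1
  have hp1 : ContDiff ℝ 1 (p t) := contDiff_infty.1 (h.smooth_pressure.contDiff_slice ht) 1
  have hψ1 : ContDiff ℝ 1 ψt := hψ.of_le one_le_two
  have huc : Continuous (u t) := hu1.continuous
  have hwc : Continuous (w t) := hw1.continuous
  have hψc : Continuous ψt := hψ1.continuous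
  -- the time derivative through the equation
  have hdt_eq : ∀ x, timeDerivWithin S u t x =
      ν • (Δ (u t)) x - gradient (p t) x - convect (w t) (u t) x := fun x => by
    rw [← h.momentum t ht x]; abel
  -- integrability of every pairing with `ψt`
  have iC : Integrable (fun x => ⟪convect (w t) (u t) x, ψt x⟫) (volume : Measure E) :=
    integrable_inner_of_hasCompactSupport_right
      ((hu1.continuous_fderiv one_ne_zero).clm_apply hwc) hψc hc
  have iL := integrable_inner_of_hasCompactSupport_right (continuous_laplacian hu2) hψc hc
  have iP := integrable_inner_of_hasCompactSupport_right (continuous_gradient_of_contDiff hp1)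
    hψc hc
  have iC' : Integrable (fun x => ⟪u t x, convect (w t) ψt x⟫) (volume : Measure E) :=
    integrable_inner_of_hasCompactSupport_right huc
      ((hψ1.continuous_fderiv one_ne_zero).clm_apply hwc)
      ((hc.fderiv (𝕜 := ℝ)).mono fun x hx => by
        contrapose! hx; simp only [mem_support, not_not] at hx; simp [convect, hx])
  have iL' : Integrable (fun x => ⟪u t x, (Δ ψt) x⟫) (volume : Measure E) :=
    integrable_inner_of_hasCompactSupport_right huc (continuous_laplacian hψ)
      (hc.mono' fun x hx => by
        contrapose! hx; simp [laplacian_eq_zero_of_notMem_tsupport hx])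
  -- integration by parts, term by term
  have eC : ∫ x, ⟪convect (w t) (u t) x, ψt x⟫ = -∫ x, ⟪u t x, convect (w t) ψt x⟫ := by
    have h0 := integral_inner_convect_add_eq_zero hw1 hu1 hψ1 hc
    have hz : ∫ x, VectorCalculus.divergence (w t) x * ⟪u t x, ψt x⟫ = 0 := by
      simp [h.divFree_drift t ht _]
    linarith
  have eL : ∫ x, ⟪(Δ (u t)) x, ψt x⟫ = ∫ x, ⟪u t x, (Δ ψt) x⟫ :=
    integral_inner_laplacian_comm hu2 hψ hc
  have eP : ∫ x, ⟪gradient (p t) x, ψt x⟫ = 0 := by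
    rw [integral_inner_gradient_eq_neg_integral_mul_divergence hp1 hψ1 hc]
    simp [hdiv _]
  -- assemble
  have key : ∀ x, ⟪timeDerivWithin S u t x, ψt x⟫ =
      ν * ⟪(Δ (u t)) x, ψt x⟫ - ⟪gradient (p t) x, ψt x⟫ - ⟪convect (w t) (u t) x, ψt x⟫ := by
    intro x
    rw [hdt_eq x]
    simp only [inner_sub_left, inner_smul_left, RCLike.conj_to_real]
  have j1 : Integrable (fun x => ν * ⟪(Δ (u t)) x, ψt x⟫ - ⟪gradient (p t) x, ψt x⟫)
      (volume : Measure E) := (iL.const_mul ν).sub iP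
  have j2 : Integrable (fun x => ν * ⟪u t x, (Δ ψt) x⟫) (volume : Measure E) := iL'.const_mul ν
  rw [integral_congr_ae (Eventually.of_forall key), integral_sub j1 iC,
    integral_sub (iL.const_mul ν) iP, integral_const_mul, integral_add iC' j2,
    integral_const_mul, eC, eL, eP]
  ring

/-- **The two-time weak form of the drift system for classical solutions.** Let `(w, u, p)` be a
classical solution of `∂ₜu + (w·∇)u = νΔu − ∇p`, `div u = div w = 0` on a time set `S` of unique
differentiability with `[s, t] ⊆ S`, and let `ψ` be a smooth compactly supported space–time field
with divergence-free slices. Then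
`⟪u(t), ψ(t)⟫ − ⟪u(s), ψ(s)⟫ = ∫ₛᵗ ∫ (⟪u, ∂ₜψ⟫ + ⟪u, (w·∇)ψ⟫ + ν⟪u, Δψ⟫) dx dτ`
(the slice identity, the fundamental theorem of calculus on each time line `τ ↦ ⟪u(τ,x), ψ(τ,x)⟫`
and Fubini over the compact `x`-shadow of `ψ`; Leray 1934, §III (17); Ożański–Pooley 2018, (6.89)
"between two times"). The shape is that of the `regularised` field of
`IsLerayRegularisedScheme` / `leray_regularised_wellposed`. [cite: OzanskiPooley2018, (6.89)] -/
theorem IsClassicalDriftNSSolutionOn.inner_sub_inner_eq_intervalIntegral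
    (h : IsClassicalDriftNSSolutionOn S ν w u p) (hS : UniqueDiffOn ℝ S) {ψ : ℝ → E → E}
    (hψ : IsSpaceTimeTestOn (⊤ : Opens (ℝ × E)) ψ) (hdiv : ∀ τ, VectorCalculus.IsDivFree (ψ τ))
    {s t : ℝ} (hst : s ≤ t) (hI : Icc s t ⊆ S) :
    (∫ x, ⟪u t x, ψ t x⟫) - ∫ x, ⟪u s x, ψ s x⟫ =
      ∫ τ in s..t, ∫ x, (⟪u τ x, timeDeriv ψ τ x⟫ +
        ⟪u τ x, convect (w τ) (ψ τ) x⟫ + ν * ⟪u τ x, Δ (ψ τ) x⟫) := by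
  -- the compact `x`-shadow of `ψ`
  obtain ⟨K, hK, hKt⟩ := hψ.exists_compact_slice_subset
  have hψ0 : ∀ τ, ∀ x ∉ K, ψ τ x = 0 := fun τ x hx =>
    image_eq_zero_of_notMem_tsupport fun h' => hx (hKt τ h')
  have hT0 : ∀ τ, ∀ x ∉ K, timeDeriv ψ τ x = 0 := fun τ x hx =>
    timeDeriv_eq_zero_of_forall (fun τ' => hψ0 τ' x hx) τ
  -- joint continuity
  have hu_cont : ContinuousOn (uncurry u) (S ×ˢ univ) := h.smooth_velocity.continuousOn
  have hdt_cont : ContinuousOn (uncurry (timeDerivWithin S u)) (S ×ˢ univ) :=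
    (h.smooth_velocity.timeDerivWithin hS).continuousOn
  have cψ : Continuous (uncurry ψ) := hψ.contDiff.continuous
  have cTψ : Continuous (uncurry (timeDeriv ψ)) := hψ.continuous_timeDeriv
  have hsub : Icc s t ×ˢ (univ : Set E) ⊆ S ×ˢ univ := prod_mono hI Subset.rfl
  -- the time-line integrand
  set D : ℝ × E → ℝ := fun z => ⟪timeDerivWithin S u z.1 z.2, ψ z.1 z.2⟫ +
    ⟪u z.1 z.2, timeDeriv ψ z.1 z.2⟫ with hD
  have hDcont : ContinuousOn D (Icc s t ×ˢ univ) :=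
    ((hdt_cont.mono hsub).inner cψ.continuousOn).add ((hu_cont.mono hsub).inner cTψ.continuousOn)
  have hDK : ∀ τ ∈ Icc s t, ∀ x ∉ K, D (τ, x) = 0 := fun τ _ x hx => by
    simp only [hD, hψ0 τ x hx, hT0 τ x hx, inner_zero_right, add_zero]
  have hDint := integrable_prod_of_continuousOn hK hDcont hDK
  -- Step 1: the fundamental theorem of calculus on each time line
  have htS : t ∈ S := hI (right_mem_Icc.2 hst)
  have hsS : s ∈ S := hI (left_mem_Icc.2 hst)
  have hline : ∀ x, ∫ τ in Ioo s t, D (τ, x) = ⟪u t x, ψ t x⟫ - ⟪u s x, ψ s x⟫ := by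
    intro x
    rcases eq_or_lt_of_le hst with rfl | hst'
    · simp
    have hcont : ContinuousOn (fun τ => ⟪u τ x, ψ τ x⟫) (Icc s t) :=
      (hu_cont.comp (Continuous.prodMk_left x).continuousOn
        fun τ hτ => mk_mem_prod (hI hτ) (mem_univ x)).inner
        (cψ.comp (Continuous.prodMk_left x)).continuousOn
    have hderiv : ∀ τ ∈ Ioo s t, HasDerivWithinAt (fun τ => ⟪u τ x, ψ τ x⟫) (D (τ, x)) (Ioi τ) τ := by
      intro τ hτ
      have hτS : τ ∈ S := hI (Ioo_subset_Icc_self hτ)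
      have hSn : S ∈ 𝓝 τ := mem_of_superset (Ioo_mem_nhds hτ.1 hτ.2)
        (Ioo_subset_Icc_self.trans hI)
      have hu' : HasDerivAt (fun σ => u σ x) (timeDerivWithin S u τ x) τ :=
        (h.smooth_velocity.hasDerivWithinAt_timeDerivWithin hS hτS x).hasDerivAt hSn
      have hψ' : HasDerivAt (fun σ => ψ σ x) (timeDeriv ψ τ x) τ := hψ.hasDerivAt_time τ x
      have h2 := (hu'.inner ℝ hψ').hasDerivWithinAt (s := Ioi τ)
      refine h2.congr_deriv ?_
      simp only [hD]
      rw [add_comm, real_inner_comm (timeDeriv ψ τ x)]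
    have hint : IntervalIntegrable (fun τ => D (τ, x)) volume s t := by
      refine ContinuousOn.intervalIntegrable ?_
      rw [uIcc_of_le hst]
      exact hDcont.comp (Continuous.prodMk_left x).continuousOn
        fun τ hτ => mk_mem_prod hτ (mem_univ x)
    have := intervalIntegral.integral_eq_sub_of_hasDeriv_right_of_le hst hcont hderiv hint
    rw [intervalIntegral.integral_of_le hst, integral_Ioc_eq_integral_Ioo] at this
    exact this
  -- Step 2: Fubini
  have hswap := integral_integral_swap (f := fun τ x => D (τ, x)) hDint
  have hslice : ∀ {r : ℝ}, r ∈ S → Integrable (fun x => ⟪u r x, ψ r x⟫) (volume : Measure E) :=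
    fun hr => integrable_inner_of_hasCompactSupport_right (h.smooth_velocity.contDiff_slice hr).continuous
      (hψ.contDiff_slice _).continuous (hψ.hasCompactSupport_slice _)
  have hLHS : (∫ x, ⟪u t x, ψ t x⟫) - ∫ x, ⟪u s x, ψ s x⟫ = ∫ τ in Ioo s t, ∫ x, D (τ, x) := by
    rw [hswap, integral_congr_ae (Eventually.of_forall hline), integral_sub (hslice htS) (hslice hsS)]
  -- Step 3: the slice identity inside the time integral
  rw [hLHS, intervalIntegral.integral_of_le hst, integral_Ioc_eq_integral_Ioo]
  refine setIntegral_congr_fun measurableSet_Ioo fun τ hτ => ?_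
  have hτS : τ ∈ S := hI (Ioo_subset_Icc_self hτ)
  have hψ2 : ContDiff ℝ 2 (ψ τ) := contDiff_infty.1 (hψ.contDiff_slice τ) 2
  have hψ1 : ContDiff ℝ 1 (ψ τ) := hψ2.of_le one_le_two
  have key := h.integral_inner_timeDerivWithin_test hτS hψ2 (hψ.hasCompactSupport_slice τ) (hdiv τ)
  have huc : Continuous (u τ) := (h.smooth_velocity.contDiff_slice hτS).continuous
  have hwc : Continuous (w τ) := (h.smooth_drift.contDiff_slice hτS).continuous
  have i1 : Integrable (fun x => ⟪timeDerivWithin S u τ x, ψ τ x⟫) (volume : Measure E) :=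
    integrable_inner_of_hasCompactSupport_right
      (((h.smooth_velocity.timeDerivWithin hS).contDiff_slice hτS).continuous)
      (hψ.contDiff_slice τ).continuous (hψ.hasCompactSupport_slice τ)
  have i2 : Integrable (fun x => ⟪u τ x, timeDeriv ψ τ x⟫) (volume : Measure E) :=
    integrable_inner_of_hasCompactSupport_right huc
      (hψ.continuous_timeDeriv.comp (Continuous.prodMk_right τ))
      (HasCompactSupport.intro hK fun x hx => hT0 τ x hx)
  have iC' : Integrable (fun x => ⟪u τ x, convect (w τ) (ψ τ) x⟫) (volume : Measure E) :=
    integrable_inner_of_hasCompactSupport_right huc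
      ((hψ1.continuous_fderiv one_ne_zero).clm_apply hwc)
      (((hψ.hasCompactSupport_slice τ).fderiv (𝕜 := ℝ)).mono fun x hx => by
        contrapose! hx; simp only [mem_support, not_not] at hx; simp [convect, hx])
  have iL' : Integrable (fun x => ⟪u τ x, (Δ (ψ τ)) x⟫) (volume : Measure E) :=
    integrable_inner_of_hasCompactSupport_right huc (continuous_laplacian hψ2)
      ((hψ.hasCompactSupport_slice τ).mono' fun x hx => by
        contrapose! hx; simp [laplacian_eq_zero_of_notMem_tsupport hx])
  have j2 : Integrable (fun x => ν * ⟪u τ x, (Δ (ψ τ)) x⟫) (volume : Measure E) := iL'.const_mul ν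
  have j3 : Integrable (fun x => ⟪u τ x, timeDeriv ψ τ x⟫ + ⟪u τ x, convect (w τ) (ψ τ) x⟫)
      (volume : Measure E) := i2.add iC'
  simp only [hD]
  rw [integral_add i1 i2, key, integral_add j3 j2, integral_add i2 iC', integral_add iC' j2]
  ring

end Literature.Analysis.FluidPDE

end
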